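import Summits.AtomisticToContinuum.Crystallization.Theorems.FrustratedLawDichotomyStrainedPatchHomForceRingLJ
import Summits.AtomisticToContinuum.Crystallization.Theorems.FrustratedLawDichotomyStrainedPatchHomCurvLeaf2
import Summits.AtomisticToContinuum.Crystallization.Theorems.FrustratedLawDichotomyStrainedPatchHomCurvCoeff3
import Summits.AtomisticToContinuum.Crystallization.Theorems.FrustratedLawDichotomyStrainedPatchHomHertzKit

/-!
# The LJ7 FORCE-JACOBIAN certificate, NAIVE form (per-label interval coefficients + sign-vertex PSD test): kernel Boolean + soundness
# (first instrument of the row-1089 GATE «c_λ of the force-Jacobian kit»; 27623 `(H) HomFloor (1/625)`, hcp half, ring leaf [F])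

decomp-a2c hand-2 g29 (crux `AperiodicFrustratedLawGap`, stmt-AtomisticToContinuum-27623).  For a `(U, ξ)`-box `(c, w)` and a label list `L` the Boolean
`forceJacCheckN c w L lamS` encloses, for every label `b ∈ L`, the shifted-family point `X_b = latPt U hexFrame b + U(hcpShift + ξ')` over the box
(`…HomForceKit.vecB`), its squared length `Q_b` (`dot3`), the pure Lennard-Jones Hessian coefficients `alphaLJ ‖X_b‖ ∈ (ljTripleFI Q_b).1`
(`…HomCurvCoeff3`) and `betaLJ ‖X_b‖ = Q_b⁻⁴ − Q_b⁻⁷ ∈ phiFI Q_b` (`…HomForceKit`), accumulates the interval Jacobian `Σ_b (α_b X_b X_bᵀ + β_b I)`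
(`…HomCurvKit.hessEntryFI`) and tests `⪰ lamS/SC` by `…HomHertzKit.hertzTest` (perturbation `0`).  NAIVE = no centring: the per-label intervals carry the
whole box variation (hand-1's v0 curvature leaf did the same for `W₄₅`); the centred twin (c_λ ≥ 0.85 at 2⁻¹¹ required by row 1089) is the successor.

* §1 `fjE`, `fjX`, `fjVec`, `fjQ`, `fjAlpha`, `fjBeta`, ★ `forceJacCheckN`, `fjLabels` (labels of `[−7,7]³` possibly within `√(r2n/r2d)`);
* §2 ★★ `forceJac_floor_of_checkN` — the HESSIAN-FORM Jacobian floor along the segment (the `hjac` input of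
  `…HomForceRing.hcpForceLJ_exterior_of_hessForm`) for every `U` of the entry box and every reference/target shuffle `ξ₀, ξ` of the shuffle box;
* §3 ★★★ `hcpForceLJ_exterior_of_checkN` / `hcpForceLJ_slab_of_checkN` — the exterior force bound and the slab confinement `T″` from ONE Boolean.

Label-box caveat (documented, not hidden): `fjLabels` filters hand-1's `boxLabels7 = [−7,7]³`; for the production [F] certificate the list must be the
`[−11,11]³` box of `…HomExemptMoveBox` cut at `‖v‖ ≤ 7` (the lemmas here hold for ANY list; only the identification with the exempt kernel's indicator
sum needs the right one).
Kernel definitions + soundness; 0 sorry; standard axioms; no instances / notation / `#eval`.  `--supports stmt-AtomisticToContinuum-27623`.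
-/

noncomputable section

namespace Summit.AtomisticToContinuum.Crystallization.Theorems.FrustratedLawDichotomyStrainedPatchHomForceJacN

open scoped BigOperators RealInnerProductSpace
open Literature.Analysis.ValidatedNumerics.Numerics
open Summit.AtomisticToContinuum.Crystallization.Theorems.ChargedEnergyGapNegative (E3)
open Summit.AtomisticToContinuum.Crystallization.Theorems.FrustratedLawDichotomyStrainedPatchHomSplit (latPt hexFrame hcpShift)
open Summit.AtomisticToContinuum.Crystallization.Theorems.FrustratedLawDichotomyStrainedPatchHomEntryGram (entryFI mem_entryFI)
open Summit.AtomisticToContinuum.Crystallization.Theorems.FrustratedLawDichotomyStrainedPatchHomEntryGramHcp (dot3 shufFI mem_dot3 mem_shufFI)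
open Summit.AtomisticToContinuum.Crystallization.Theorems.FrustratedLawDichotomyStrainedPatchHomForceKit (vecB mem_vecB phiFI mem_phiFI)
open Summit.AtomisticToContinuum.Crystallization.Theorems.FrustratedLawDichotomyStrainedPatchHomCurvRegime3 (alphaLJ betaLJ)
open Summit.AtomisticToContinuum.Crystallization.Theorems.FrustratedLawDichotomyStrainedPatchHomCurvCoeff3 (ljTripleFI mem_ljTripleFI inv_sq_pow)
open Summit.AtomisticToContinuum.Crystallization.Theorems.FrustratedLawDichotomyStrainedPatchHomCurvKit (hessEntryFI)
open Summit.AtomisticToContinuum.Crystallization.Theorems.FrustratedLawDichotomyStrainedPatchHomHertzKit (hertzTest curvatureSum_ge_of_hertzTest0)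
open Summit.AtomisticToContinuum.Crystallization.Theorems.FrustratedLawDichotomyStrainedPatchHomCurvLeaf (boxLabels7 abs_sub_le_of_segment)
open Summit.AtomisticToContinuum.Crystallization.Theorems.FrustratedLawDichotomyStrainedPatchHomForceRing
  (hcpForceLJ_exterior_of_hessForm hcpForceLJ_slab_confinement_of_hessForm)

/-! ## §1. The kernel Boolean -/

/-- Entry intervals of the box. -/
def fjE (c w : (Fin 3 × Fin 3) ⊕ Fin 3 → ℤ) : Fin 3 × Fin 3 → FI := entryFI (fun ab => c (Sum.inl ab)) (fun ab => w (Sum.inl ab))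

/-- Shuffle intervals of the box. -/
def fjX (c w : (Fin 3 × Fin 3) ⊕ Fin 3 → ℤ) : Fin 3 → FI := shufFI c w

/-- Interval vector of the shifted-family point `X_b`. -/
def fjVec (c w : (Fin 3 × Fin 3) ⊕ Fin 3 → ℤ) (b : Fin 3 → ℤ) (a : Fin 3) : FI := vecB (fjE c w) (fjX c w) b a

/-- Interval of `‖X_b‖²`. -/
def fjQ (c w : (Fin 3 × Fin 3) ⊕ Fin 3 → ℤ) (b : Fin 3 → ℤ) : FI := dot3 (fjVec c w b) (fjVec c w b)

/-- Interval of `alphaLJ ‖X_b‖` (none if the squared radius may vanish). -/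
def fjAlpha (c w : (Fin 3 × Fin 3) ⊕ Fin 3 → ℤ) (b : Fin 3 → ℤ) : Option FI := (ljTripleFI (fjQ c w b)).map fun T => T.1

/-- Interval of `betaLJ ‖X_b‖ = (‖X_b‖²)⁻⁴ − (‖X_b‖²)⁻⁷`. -/
def fjBeta (c w : (Fin 3 × Fin 3) ⊕ Fin 3 → ℤ) (b : Fin 3 → ℤ) : Option FI := phiFI (fjQ c w b)

/-- Labels of `[−7,7]³` whose squared radius can go below `r2n/r2d` on the box. -/
def fjLabels (c w : (Fin 3 × Fin 3) ⊕ Fin 3 → ℤ) (r2n : ℤ) (r2d : ℕ) : List (Fin 3 → ℤ) :=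
  boxLabels7.filter fun b => decide ((fjQ c w b).lo < (FI.ofFrac r2n r2d).hi)

/-- ★ **THE NAIVE FORCE-JACOBIAN CERTIFICATE**: every label of `L` has its two coefficient intervals, and the interval Jacobian is `⪰ lamS/SC` by the
sign-vertex / LDLᵀ test. -/
def forceJacCheckN (c w : (Fin 3 × Fin 3) ⊕ Fin 3 → ℤ) (L : List (Fin 3 → ℤ)) (lamS : ℤ) : Bool :=
  (L.all fun b => (fjAlpha c w b).isSome && (fjBeta c w b).isSome) &&
    hertzTest (hessEntryFI L (fun b => (fjAlpha c w b).getD (FI.ofInt 0)) (fun b => (fjBeta c w b).getD (FI.ofInt 0)) (fjVec c w))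
      (fun _ _ => 0) lamS

/-! ## §2. Soundness: the Hessian-form Jacobian floor along the segment -/

/-- `betaLJ ρ = (ρ²)⁻⁴ − (ρ²)⁻⁷`. [arithmetic] -/
theorem betaLJ_eq_sq (ρ : ℝ) : betaLJ ρ = ((ρ ^ 2)⁻¹) ^ 4 - ((ρ ^ 2)⁻¹) ^ 7 := by
  rw [betaLJ, inv_sq_pow, inv_sq_pow]

/-- Per-label memberships at a point `(U, ξ')` of the box. [folklore] -/
theorem mem_coeffs {c w : (Fin 3 × Fin 3) ⊕ Fin 3 → ℤ} (U : E3 →L[ℝ] E3)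
    (hbox : ∀ ab : Fin 3 × Fin 3, |(U (EuclideanSpace.single ab.2 (1 : ℝ))) ab.1 - (c (Sum.inl ab) : ℝ) / SC| ≤ (w (Sum.inl ab) : ℝ) / SC)
    (ξ' : E3) (hξ' : ∀ i : Fin 3, |ξ' i - (c (Sum.inr i) : ℝ) / SC| ≤ (w (Sum.inr i) : ℝ) / SC) (b : Fin 3 → ℤ)
    {A B : FI} (hA : fjAlpha c w b = some A) (hB : fjBeta c w b = some B) :
    (∀ a, FI.mem ((latPt U hexFrame b + U (hcpShift + ξ')) a) (fjVec c w b a)) ∧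
      FI.mem (alphaLJ ‖latPt U hexFrame b + U (hcpShift + ξ')‖) A ∧ FI.mem (betaLJ ‖latPt U hexFrame b + U (hcpShift + ξ')‖) B := by
  have hE : ∀ ab : Fin 3 × Fin 3, FI.mem ((U (EuclideanSpace.single ab.2 (1 : ℝ))) ab.1) (fjE c w ab) := fun ab => mem_entryFI (hbox ab)
  have hX : ∀ i, FI.mem (ξ' i) (fjX c w i) := fun i => mem_shufFI (hξ' i)
  have hv : ∀ a, FI.mem ((latPt U hexFrame b + U (hcpShift + ξ')) a) (fjVec c w b a) := fun a => mem_vecB U ξ' hE hX b a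
  have hq : FI.mem (‖latPt U hexFrame b + U (hcpShift + ξ')‖ ^ 2) (fjQ c w b) := by
    rw [← real_inner_self_eq_norm_sq]
    exact mem_dot3 hv hv
  refine ⟨hv, ?_, ?_⟩
  · unfold fjAlpha at hA
    cases hT : ljTripleFI (fjQ c w b) with
    | none => rw [hT] at hA; exact absurd hA (by simp)
    | some T =>
      rw [hT] at hA
      simp only [Option.map_some, Option.some.injEq] at hA
      rw [← hA]
      exact (mem_ljTripleFI hq hT).1
  · rw [betaLJ_eq_sq]
    exact mem_phiFI hq hB

/-- ★★ **SOUNDNESS OF `forceJacCheckN`**: for every `U` of the entry box (`‖U − 1‖ ≤ 1/4`), every reference and target shuffle `ξ₀, ξ` of the shuffle box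
and every `s ∈ (0,1)`: `(lamS/SC)·‖U(ξ − ξ₀)‖² ≤ Σ_{b ∈ L} (alphaLJ ‖X_b(s)‖ ⟪X_b(s), U(ξ − ξ₀)⟫² + betaLJ ‖X_b(s)‖ ‖U(ξ − ξ₀)‖²)`,
`X_b(s) = latPt U hexFrame b + U(hcpShift + ξ₀) + s·U(ξ − ξ₀)` — the `hjac` input of `…HomForceRing.hcpForceLJ_exterior_of_hessForm`. [folklore chaining] -/
theorem forceJac_floor_of_checkN {c w : (Fin 3 × Fin 3) ⊕ Fin 3 → ℤ} {L : List (Fin 3 → ℤ)} (hL : L.Nodup) {lamS : ℤ}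
    (h : forceJacCheckN c w L lamS = true) (U : E3 →L[ℝ] E3)
    (hbox : ∀ ab : Fin 3 × Fin 3, |(U (EuclideanSpace.single ab.2 (1 : ℝ))) ab.1 - (c (Sum.inl ab) : ℝ) / SC| ≤ (w (Sum.inl ab) : ℝ) / SC)
    (ξ₀ ξ : E3) (hξ₀ : ∀ i : Fin 3, |ξ₀ i - (c (Sum.inr i) : ℝ) / SC| ≤ (w (Sum.inr i) : ℝ) / SC)
    (hξ : ∀ i : Fin 3, |ξ i - (c (Sum.inr i) : ℝ) / SC| ≤ (w (Sum.inr i) : ℝ) / SC) {s : ℝ} (hs : s ∈ Set.Ioo (0 : ℝ) 1) :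
    (lamS : ℝ) / SC * ‖U (ξ - ξ₀)‖ ^ 2 ≤
      ∑ bb ∈ L.toFinset, (alphaLJ ‖latPt U hexFrame bb + U (hcpShift + ξ₀) + s • U (ξ - ξ₀)‖ *
          ⟪latPt U hexFrame bb + U (hcpShift + ξ₀) + s • U (ξ - ξ₀), U (ξ - ξ₀)⟫ ^ 2 +
        betaLJ ‖latPt U hexFrame bb + U (hcpShift + ξ₀) + s • U (ξ - ξ₀)‖ * ‖U (ξ - ξ₀)‖ ^ 2) := by
  classical
  unfold forceJacCheckN at h
  simp only [Bool.and_eq_true, List.all_eq_true] at h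
  obtain ⟨hall, hhz⟩ := h
  -- the intermediate shuffle lies in the box
  set η : E3 := ξ₀ + s • (ξ - ξ₀) with hη
  have hηbox : ∀ i : Fin 3, |η i - (c (Sum.inr i) : ℝ) / SC| ≤ (w (Sum.inr i) : ℝ) / SC := by
    intro i
    have : η i = ξ₀ i + s * (ξ i - ξ₀ i) := by simp [hη]
    rw [this]
    exact abs_sub_le_of_segment (hξ₀ i) (hξ i) hs.1.le hs.2.le
  have hpt : ∀ bb : Fin 3 → ℤ, latPt U hexFrame bb + U (hcpShift + ξ₀) + s • U (ξ - ξ₀) = latPt U hexFrame bb + U (hcpShift + η) := by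
    intro bb; simp only [hη, map_add, map_smul]; abel
  simp only [hpt]
  -- per-label data
  have hsome : ∀ b ∈ L, ∃ A B, fjAlpha c w b = some A ∧ fjBeta c w b = some B := by
    intro b hb
    obtain ⟨h1, h2⟩ := hall b hb
    obtain ⟨A, hA⟩ := Option.isSome_iff_exists.1 h1
    obtain ⟨B, hB⟩ := Option.isSome_iff_exists.1 h2
    exact ⟨A, B, hA, hB⟩
  refine curvatureSum_ge_of_hertzTest0 L hL (α := fun b => alphaLJ ‖latPt U hexFrame b + U (hcpShift + η)‖)
    (β := fun b => betaLJ ‖latPt U hexFrame b + U (hcpShift + η)‖) (c := fun b => latPt U hexFrame b + U (hcpShift + η))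
    (fun b hb => ?_) (fun b hb => ?_) (fun b hb a => ?_) hhz (U (ξ - ξ₀))
  · obtain ⟨A, B, hA, hB⟩ := hsome b hb
    have := (mem_coeffs U hbox η hηbox b hA hB).2.1
    rw [hA]; simpa using this
  · obtain ⟨A, B, hA, hB⟩ := hsome b hb
    have := (mem_coeffs U hbox η hηbox b hA hB).2.2
    rw [hB]; simpa using this
  · obtain ⟨A, B, hA, hB⟩ := hsome b hb
    exact (mem_coeffs U hbox η hηbox b hA hB).1 a

/-! ## §3. The exterior force bound and the slab confinement from ONE Boolean -/

/-- ★★★ **EXTERIOR FORCE BOUND FROM `forceJacCheckN`** (plus the reference bound `f₀` at `ξ₀`): for every `U` of the entry box with `‖U − 1‖ ≤ 1/4` and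
all shuffles `ξ₀, ξ` of the shuffle box with norms `≤ 1/4`,
`((lamS/SC)‖U(ξ−ξ₀)‖ − f₀)‖U(ξ−ξ₀)‖ ≤ Σ_{b∈L} (‖X_b‖⁻⁸ − ‖X_b‖⁻¹⁴)⟪X_b, U(ξ−ξ₀)⟫`, `X_b = latPt U hexFrame b + U(hcpShift + ξ)`. [folklore chaining] -/
theorem hcpForceLJ_exterior_of_checkN {c w : (Fin 3 × Fin 3) ⊕ Fin 3 → ℤ} {L : List (Fin 3 → ℤ)} (hL : L.Nodup) {lamS : ℤ}
    (h : forceJacCheckN c w L lamS = true) {U : E3 →L[ℝ] E3} (hU : ‖U - 1‖ ≤ 1 / 4)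
    (hbox : ∀ ab : Fin 3 × Fin 3, |(U (EuclideanSpace.single ab.2 (1 : ℝ))) ab.1 - (c (Sum.inl ab) : ℝ) / SC| ≤ (w (Sum.inl ab) : ℝ) / SC)
    {ξ₀ ξ : E3} (hξ₀ : ∀ i : Fin 3, |ξ₀ i - (c (Sum.inr i) : ℝ) / SC| ≤ (w (Sum.inr i) : ℝ) / SC)
    (hξ : ∀ i : Fin 3, |ξ i - (c (Sum.inr i) : ℝ) / SC| ≤ (w (Sum.inr i) : ℝ) / SC) (hn₀ : ‖ξ₀‖ ≤ 1 / 4) (hn : ‖ξ‖ ≤ 1 / 4) {f₀ : ℝ}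
    (hf₀ : |∑ bb ∈ L.toFinset, (‖latPt U hexFrame bb + U (hcpShift + ξ₀)‖⁻¹ ^ 8 - ‖latPt U hexFrame bb + U (hcpShift + ξ₀)‖⁻¹ ^ 14) *
        ⟪latPt U hexFrame bb + U (hcpShift + ξ₀), U (ξ - ξ₀)⟫| ≤ f₀ * ‖U (ξ - ξ₀)‖) :
    ((lamS : ℝ) / SC * ‖U (ξ - ξ₀)‖ - f₀) * ‖U (ξ - ξ₀)‖ ≤
      ∑ bb ∈ L.toFinset, (‖latPt U hexFrame bb + U (hcpShift + ξ)‖⁻¹ ^ 8 - ‖latPt U hexFrame bb + U (hcpShift + ξ)‖⁻¹ ^ 14) *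
        ⟪latPt U hexFrame bb + U (hcpShift + ξ), U (ξ - ξ₀)⟫ :=
  hcpForceLJ_exterior_of_hessForm L.toFinset hU hn₀ hn (fun _ hs => forceJac_floor_of_checkN hL h U hbox ξ₀ ξ hξ₀ hξ hs) hf₀

/-- ★★★ **SLAB CONFINEMENT `T″` FROM `forceJacCheckN`**: with the reference bound `f₀` and a cap `σ` on the target's force component (e.g. a non-exempt
site), `(lamS/SC)‖U(ξ−ξ₀)‖ ≤ σ + f₀` and `(lamS/SC)·(3/4)‖ξ − ξ₀‖ ≤ σ + f₀` (if `0 ≤ lamS`). [folklore chaining] -/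
theorem hcpForceLJ_slab_of_checkN {c w : (Fin 3 × Fin 3) ⊕ Fin 3 → ℤ} {L : List (Fin 3 → ℤ)} (hL : L.Nodup) {lamS : ℤ}
    (h : forceJacCheckN c w L lamS = true) {U : E3 →L[ℝ] E3} (hU : ‖U - 1‖ ≤ 1 / 4)
    (hbox : ∀ ab : Fin 3 × Fin 3, |(U (EuclideanSpace.single ab.2 (1 : ℝ))) ab.1 - (c (Sum.inl ab) : ℝ) / SC| ≤ (w (Sum.inl ab) : ℝ) / SC)
    {ξ₀ ξ : E3} (hξ₀ : ∀ i : Fin 3, |ξ₀ i - (c (Sum.inr i) : ℝ) / SC| ≤ (w (Sum.inr i) : ℝ) / SC)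
    (hξ : ∀ i : Fin 3, |ξ i - (c (Sum.inr i) : ℝ) / SC| ≤ (w (Sum.inr i) : ℝ) / SC) (hn₀ : ‖ξ₀‖ ≤ 1 / 4) (hn : ‖ξ‖ ≤ 1 / 4)
    (hΔ : U (ξ - ξ₀) ≠ 0) {f₀ σ : ℝ}
    (hf₀ : |∑ bb ∈ L.toFinset, (‖latPt U hexFrame bb + U (hcpShift + ξ₀)‖⁻¹ ^ 8 - ‖latPt U hexFrame bb + U (hcpShift + ξ₀)‖⁻¹ ^ 14) *
        ⟪latPt U hexFrame bb + U (hcpShift + ξ₀), U (ξ - ξ₀)⟫| ≤ f₀ * ‖U (ξ - ξ₀)‖)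
    (hσ : ∑ bb ∈ L.toFinset, (‖latPt U hexFrame bb + U (hcpShift + ξ)‖⁻¹ ^ 8 - ‖latPt U hexFrame bb + U (hcpShift + ξ)‖⁻¹ ^ 14) *
        ⟪latPt U hexFrame bb + U (hcpShift + ξ), U (ξ - ξ₀)⟫ ≤ σ * ‖U (ξ - ξ₀)‖) :
    (lamS : ℝ) / SC * ‖U (ξ - ξ₀)‖ ≤ σ + f₀ ∧ (0 ≤ (lamS : ℝ) / SC → (lamS : ℝ) / SC * (3 / 4 * ‖ξ - ξ₀‖) ≤ σ + f₀) :=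
  hcpForceLJ_slab_confinement_of_hessForm L.toFinset hU hn₀ hn hΔ (fun _ hs => forceJac_floor_of_checkN hL h U hbox ξ₀ ξ hξ₀ hξ hs) hf₀ hσ

end Summit.AtomisticToContinuum.Crystallization.Theorems.FrustratedLawDichotomyStrainedPatchHomForceJacN

end
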